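import Literature.Probability.LatticeModels.BlockExplorationTransport
import HarnessLib

/-!
# Transport of the conditional inside probabilities of an exploration datum along a window
embedding: the rim wired OFF the inside (proved)

Topic `Literature/Probability/LatticeModels` (trunk `StatMech`, family `crit-ising`); companion of
`BlockExplorationTransport.lean`. In the multi-scale chain of Basu–Sapozhnikov (ECP 22 (2017), §2)
the datum event `{𝒞 = U, 𝒟 = R}` of a block exploration from the inside `In` is saturated by the
clause "the rim `R` is wired through open edges of the explored set". For the chain to NEST (the
datum event of one level is the outside context of the next level, so it must be determined by the
edges avoiding the inner block) the wiring has to run OFF the inside: any two rim vertices hang,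
through open edges, off two vertices of `U ∖ In` joined by an open path inside `U ∖ In` (in the
paper this comes from the uniqueness of the crossing cluster of an annulus, which lies off the
inside). This file is the "off" copy of the transport brick (T):

* `rimWired_of_rimWiredOff` — wiring off the inside implies wiring through `U` (`openConnIn` is
  monotone in the ambient set), so the weight factorisation at the explored set of the companion
  file applies to the off-wired datum event, which is again determined by the edges touching `U`
  (`datumEventOff_iff_of_inter_eq`) and is transported along a window embedding
  (`image_rimWiredOff_iff`, `coe_map_mem_datumEventOff_iff`);
* `rcMeasure_real_explEventOff_inter_mul_eq_sum_window` — one graph: `φ_G(F ∩ A) · c` = (window sum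
  of `F_W ∩ A_W`) `· d` for the off-wired datum event `F` and every inside event `A` determined by
  the edges touching the explored set;
* `insideCond_eq_of_window_iso_off` — (T, off): `φ_{G₁}(F₁ ∩ A₁) φ_{G₂}(F₂) = φ_{G₂}(F₂ ∩ A₂) φ_{G₁}(F₁)`
  for two finite graphs isomorphic on a window containing the explored region and its neighbours.

Everything is proved; no definitions, no named facts.

## References

* [BasuSapozhnikov2017ECP] D. Basu, A. Sapozhnikov, *Kesten's incipient infinite cluster and
  quasi-multiplicativity of crossing probabilities*, Electron. Commun. Probab. 22 (2017), §2.
* H. Kesten, *Probab. Theory Related Fields* 73 (1986) 369–394, proof of Thm. 3.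
* G. Grimmett, *The Random-Cluster Model*, Springer (2006): §4.2, Lemma (4.13); §4.3.
-/

open MeasureTheory Finset SimpleGraph
open Literature.Probability.Percolation (BondConfig openConnIn explEvent)

namespace Literature.Probability.LatticeModels

/-! ### The wiring clause off the inside: monotonicity and transport -/

section Transport

variable {V W : Type*} (ι : W ↪ V)

/-- **Wiring off the inside implies wiring through the explored set**: if any two rim vertices
hang off two vertices of `U ∖ In` joined by an open path inside `U ∖ In`, they hang off two
vertices of `U` joined inside `U` (`openConnIn` is monotone in the ambient set).
[cite: BasuSapozhnikov2017ECP, §2, paragraph after eq. (2.3)] -/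
theorem rimWired_of_rimWiredOff {U In R : Set V} {ω : BondConfig V}
    (h : ∀ r ∈ R, ∀ r₂ ∈ R, ∃ v ∈ U \ In, ∃ v' ∈ U \ In,
      s(v, r) ∈ ω ∧ s(v', r₂) ∈ ω ∧ ω ∈ openConnIn (U \ In) v v') :
    ∀ r ∈ R, ∀ r₂ ∈ R, ∃ v ∈ U, ∃ v' ∈ U,
      s(v, r) ∈ ω ∧ s(v', r₂) ∈ ω ∧ ω ∈ openConnIn U v v' := by
  intro r hr r₂ hr₂
  obtain ⟨v, hv, v', hv', h1, h2, h3⟩ := h r hr r₂ hr₂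
  exact ⟨v, hv.1, v', hv'.1, h1, h2, Percolation.openConnIn_mono Set.sdiff_subset v v' h3⟩

/-- The clause "the rim is wired off the inside" is transported along the embedding (images
commute with set difference for the injective `ι`).
[cite: BasuSapozhnikov2017ECP, §2, paragraph after eq. (2.3)] -/
theorem image_rimWiredOff_iff (ζ : BondConfig W) (In U R : Set W) :
    (∀ r ∈ ι '' R, ∀ r₂ ∈ ι '' R, ∃ v ∈ ι '' U \ ι '' In, ∃ v' ∈ ι '' U \ ι '' In,
        s(v, r) ∈ Sym2.map ι '' ζ ∧ s(v', r₂) ∈ Sym2.map ι '' ζ ∧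
          Sym2.map ι '' ζ ∈ openConnIn (ι '' U \ ι '' In) v v') ↔
      ∀ r ∈ R, ∀ r₂ ∈ R, ∃ v ∈ U \ In, ∃ v' ∈ U \ In,
        s(v, r) ∈ ζ ∧ s(v', r₂) ∈ ζ ∧ ζ ∈ openConnIn (U \ In) v v' := by
  rw [← Set.image_sdiff ι.injective]
  simp only [Set.forall_mem_image, Set.exists_mem_image, map_mk_mem_image_iff,
    image_mem_openConnIn_iff]

/-- On the window: the off-wired datum event, intersected with anything, lies in the datum event
wired through `U`. [cite: BasuSapozhnikov2017ECP, §2, paragraph after eq. (2.3)] -/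
theorem windowDatumEventOff_inter_subset (In Blk U R : Set W) (AW : Set (BondConfig W)) :
    (explEvent In Blk U R ∩
        {ζ : BondConfig W | ∀ r ∈ R, ∀ r₂ ∈ R, ∃ v ∈ U \ In, ∃ v' ∈ U \ In,
          s(v, r) ∈ ζ ∧ s(v', r₂) ∈ ζ ∧ ζ ∈ openConnIn (U \ In) v v'}) ∩ AW ⊆
      explEvent In Blk U R ∩
        {ζ : BondConfig W | ∀ r ∈ R, ∀ r₂ ∈ R, ∃ v ∈ U, ∃ v' ∈ U,
          s(v, r) ∈ ζ ∧ s(v', r₂) ∈ ζ ∧ ζ ∈ openConnIn U v v'} :=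
  fun _ hζ => ⟨hζ.1.1, rimWired_of_rimWiredOff hζ.1.2⟩

end Transport

/-! ### One graph: the off-wired datum event through the window -/

section Measure

variable {V W : Type*} [Fintype V] [DecidableEq V] (G : SimpleGraph V) [DecidableRel G.Adj]
  (ι : W ↪ V)

omit [DecidableEq V] in
/-- The saturated off-wired datum event, intersected with anything, lies in the saturated datum
event wired through the explored set. [cite: BasuSapozhnikov2017ECP, §2, paragraph after eq. (2.3)] -/
theorem datumEventOff_inter_subset (In' Blk' S Rv : Set V) (A : Set (BondConfig V)) :
    {ω : BondConfig V | ω ∩ (↑G.edgeFinset : Set (Sym2 V)) ∈ explEvent In' Blk' S Rv ∩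
        {ω | ∀ r ∈ Rv, ∀ r₂ ∈ Rv, ∃ v ∈ S \ In', ∃ v' ∈ S \ In',
          s(v, r) ∈ ω ∧ s(v', r₂) ∈ ω ∧ ω ∈ openConnIn (S \ In') v v'}} ∩ A ⊆
      {ω : BondConfig V | ω ∩ (↑G.edgeFinset : Set (Sym2 V)) ∈ explEvent In' Blk' S Rv ∩
        {ω | ∀ r ∈ Rv, ∀ r₂ ∈ Rv, ∃ v ∈ S, ∃ v' ∈ S,
          s(v, r) ∈ ω ∧ s(v', r₂) ∈ ω ∧ ω ∈ openConnIn S v v'}} :=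
  fun _ hω => ⟨hω.1.1, rimWired_of_rimWiredOff hω.1.2⟩

/-- **The saturated off-wired datum event is determined by the edges touching the explored set**
(the datum event is, and the wiring clause only looks at pairs with a vertex in `S ∖ In' ⊆ S`).
[cite: BasuSapozhnikov2017ECP, §2, paragraph after eq. (2.3)] -/
theorem datumEventOff_iff_of_inter_eq {In' Blk' S Rv : Set V} {T : Finset (Sym2 V)}
    (hT : ∀ e, e ∈ T ↔ e ∈ G.edgeFinset ∧ ∃ v ∈ S, v ∈ e) (ω₁ ω₂ : BondConfig V)
    (h : ω₁ ∩ ↑T = ω₂ ∩ ↑T) :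
    ω₁ ∈ {ω : BondConfig V | ω ∩ (↑G.edgeFinset : Set (Sym2 V)) ∈ explEvent In' Blk' S Rv ∩
        {ω | ∀ r ∈ Rv, ∀ r₂ ∈ Rv, ∃ v ∈ S \ In', ∃ v' ∈ S \ In',
          s(v, r) ∈ ω ∧ s(v', r₂) ∈ ω ∧ ω ∈ openConnIn (S \ In') v v'}} ↔
      ω₂ ∈ {ω : BondConfig V | ω ∩ (↑G.edgeFinset : Set (Sym2 V)) ∈ explEvent In' Blk' S Rv ∩
        {ω | ∀ r ∈ Rv, ∀ r₂ ∈ Rv, ∃ v ∈ S \ In', ∃ v' ∈ S \ In',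
          s(v, r) ∈ ω ∧ s(v', r₂) ∈ ω ∧ ω ∈ openConnIn (S \ In') v v'}} := by
  -- the wiring clause passes between configurations agreeing on the pairs touching `S`
  have hwire : ∀ {ωa ωb : BondConfig V},
      (∀ e : Sym2 V, (∃ v ∈ S, v ∈ e) → (e ∈ ωa ↔ e ∈ ωb)) →
      (∀ r ∈ Rv, ∀ r₂ ∈ Rv, ∃ v ∈ S \ In', ∃ v' ∈ S \ In',
        s(v, r) ∈ ωa ∧ s(v', r₂) ∈ ωa ∧ ωa ∈ openConnIn (S \ In') v v') →
      ∀ r ∈ Rv, ∀ r₂ ∈ Rv, ∃ v ∈ S \ In', ∃ v' ∈ S \ In',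
        s(v, r) ∈ ωb ∧ s(v', r₂) ∈ ωb ∧ ωb ∈ openConnIn (S \ In') v v' := by
    intro ωa ωb hag h r hr r₂ hr₂
    obtain ⟨v, hv, v', hv', h1, h2, h3⟩ := h r hr r₂ hr₂
    exact ⟨v, hv, v', hv', (hag _ ⟨v, hv.1, Sym2.mem_mk_left v r⟩).1 h1,
      (hag _ ⟨v', hv'.1, Sym2.mem_mk_left v' r₂⟩).1 h2,
      Percolation.BlockExploration.openConnIn_of_agree h3 fun a ha b _ hab =>
        (hag _ ⟨a, ha.1, Sym2.mem_mk_left a b⟩).1 hab⟩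
  have hag := mem_inter_edgeFinset_iff_of_inter_eq G hT h
  rw [Set.mem_setOf_eq, Set.mem_setOf_eq, Set.mem_inter_iff, Set.mem_inter_iff,
    Percolation.mem_explEvent_iff_of_agree_on_touching hag]
  exact and_congr_right fun _ => ⟨hwire hag, hwire fun e he => (hag e he).symm⟩

omit [DecidableEq V] in
/-- **The saturated off-wired datum event of a pushed window configuration** `ι ζ`, `ζ ⊆ TW`, read
on `W`. [cite: BasuSapozhnikov2017ECP, §2, definition of F_i(U,R)] -/
theorem coe_map_mem_datumEventOff_iff {In Blk U R : Set W} {TW : Finset (Sym2 W)}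
    (hTW : ∀ e, e ∈ TW ↔ Sym2.map ι e ∈ G.edgeSet ∧ ∃ v ∈ U, v ∈ e) (ζ : Finset (Sym2 W))
    (hζ : ζ ⊆ TW) :
    (↑(ζ.map ι.sym2Map) : BondConfig V) ∈ {ω : BondConfig V | ω ∩ (↑G.edgeFinset : Set (Sym2 V)) ∈
        explEvent (ι '' In) (ι '' Blk) (ι '' U) (ι '' R) ∩
          {ω | ∀ r ∈ ι '' R, ∀ r₂ ∈ ι '' R, ∃ v ∈ ι '' U \ ι '' In, ∃ v' ∈ ι '' U \ ι '' In,
            s(v, r) ∈ ω ∧ s(v', r₂) ∈ ω ∧ ω ∈ openConnIn (ι '' U \ ι '' In) v v'}} ↔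
      (↑ζ : BondConfig W) ∈ explEvent In Blk U R ∩
        {ζ : BondConfig W | ∀ r ∈ R, ∀ r₂ ∈ R, ∃ v ∈ U \ In, ∃ v' ∈ U \ In,
          s(v, r) ∈ ζ ∧ s(v', r₂) ∈ ζ ∧ ζ ∈ openConnIn (U \ In) v v'} := by
  rw [Set.mem_setOf_eq, coe_map_inter_edgeFinset_eq G ι hTW hζ, Set.mem_inter_iff,
    Set.mem_inter_iff, image_mem_explEvent_iff, Set.mem_setOf_eq, Set.mem_setOf_eq,
    image_rimWiredOff_iff]

variable [Fintype W] [DecidableEq W]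

open Classical in
/-- **The inside probabilities of the saturated off-wired datum event, through the window.** Let
no vertex of `ι U` have a neighbour off the range of `ι : W ↪ V` and let `TW` be the window pairs
touching `U` mapped to `G`-edges. For
`F = {ω | ω ∩ E(G) ∈ {𝒞 = ι U, 𝒟 = ι R} ∩ {rim wired through ι U ∖ ι In}}` there are `c > 0`, `d`
with `φ^0_{G,p,q}(F ∩ A) · c = [∑_{ζ ⊆ TW, ζ ∈ F_W ∩ A_W} p^{|ζ|} (1-p)^{|TW ∖ ζ|} q^{k_W(ζ)}] · d`
for every `A` determined on `ι TW` that corresponds on the pushed configurations `ι ζ`, `ζ ⊆ TW`,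
to the window event `A_W` (`F_W` = the window off-wired datum event): the factorisation of the
companion file for the datum event wired through `ι U`, applied to the inside event `F ∩ A`
(`F` lies in the event wired through `ι U` and is determined by the edges touching `ι U`).
[cite: BasuSapozhnikov2017ECP, §2 (eq. (2.4)–(2.6))] -/
theorem rcMeasure_real_explEventOff_inter_mul_eq_sum_window {p q : ℝ}
    (hp : p ∈ Set.Icc (0 : ℝ) 1) (hq : 0 < q) (In Blk U R : Set W)
    (hU : ∀ a ∈ U, ∀ v : V, G.Adj (ι a) v → ∃ b : W, v = ι b)
    (TW : Finset (Sym2 W)) (hTW : ∀ e, e ∈ TW ↔ Sym2.map ι e ∈ G.edgeSet ∧ ∃ v ∈ U, v ∈ e) :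
    ∃ c d : ℝ, 0 < c ∧ ∀ (A : Set (BondConfig V)) (AW : Set (BondConfig W)),
      (∀ ω₁ ω₂ : BondConfig V, ω₁ ∩ ↑(TW.map ι.sym2Map) = ω₂ ∩ ↑(TW.map ι.sym2Map) →
        (ω₁ ∈ A ↔ ω₂ ∈ A)) →
      (∀ ζ : Finset (Sym2 W), ζ ⊆ TW →
        ((↑(ζ.map ι.sym2Map) : BondConfig V) ∈ A ↔ (↑ζ : BondConfig W) ∈ AW)) →
      (rcMeasure G p q ∅).real
          ({ω : BondConfig V | ω ∩ (↑G.edgeFinset : Set (Sym2 V)) ∈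
            explEvent (ι '' In) (ι '' Blk) (ι '' U) (ι '' R) ∩
              {ω | ∀ r ∈ ι '' R, ∀ r₂ ∈ ι '' R, ∃ v ∈ ι '' U \ ι '' In, ∃ v' ∈ ι '' U \ ι '' In,
                s(v, r) ∈ ω ∧ s(v', r₂) ∈ ω ∧ ω ∈ openConnIn (ι '' U \ ι '' In) v v'}} ∩ A) * c =
        (∑ ζ ∈ TW.powerset, if (↑ζ : BondConfig W) ∈ (explEvent In Blk U R ∩
            {ζ : BondConfig W | ∀ r ∈ R, ∀ r₂ ∈ R, ∃ v ∈ U \ In, ∃ v' ∈ U \ In,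
              s(v, r) ∈ ζ ∧ s(v', r₂) ∈ ζ ∧ ζ ∈ openConnIn (U \ In) v v'}) ∩ AW then
            p ^ #ζ * (1 - p) ^ #(TW \ ζ) * q ^ clusterCount (↑ζ : BondConfig W) ∅ else 0) * d := by
  obtain ⟨c, d, hc, h⟩ :=
    rcMeasure_real_explEvent_inter_mul_eq_sum_window G ι hp hq In Blk U R hU TW hTW
  refine ⟨c, d, hc, fun A AW hA hAW => ?_⟩
  have hT : ∀ e, e ∈ TW.map ι.sym2Map ↔ e ∈ G.edgeFinset ∧ ∃ v ∈ ι '' U, v ∈ e :=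
    mem_map_sym2Map_iff_touching G ι hU hTW
  have k := h
    ({ω : BondConfig V | ω ∩ (↑G.edgeFinset : Set (Sym2 V)) ∈
        explEvent (ι '' In) (ι '' Blk) (ι '' U) (ι '' R) ∩
          {ω | ∀ r ∈ ι '' R, ∀ r₂ ∈ ι '' R, ∃ v ∈ ι '' U \ ι '' In, ∃ v' ∈ ι '' U \ ι '' In,
            s(v, r) ∈ ω ∧ s(v', r₂) ∈ ω ∧ ω ∈ openConnIn (ι '' U \ ι '' In) v v'}} ∩ A)
    ((explEvent In Blk U R ∩
        {ζ : BondConfig W | ∀ r ∈ R, ∀ r₂ ∈ R, ∃ v ∈ U \ In, ∃ v' ∈ U \ In,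
          s(v, r) ∈ ζ ∧ s(v', r₂) ∈ ζ ∧ ζ ∈ openConnIn (U \ In) v v'}) ∩ AW)
    (fun ω₁ ω₂ h12 => and_congr (datumEventOff_iff_of_inter_eq G hT ω₁ ω₂ h12) (hA ω₁ ω₂ h12))
    (fun ζ hζ => and_congr (coe_map_mem_datumEventOff_iff G ι hTW ζ hζ) (hAW ζ hζ))
  rw [Set.inter_eq_right.2 (datumEventOff_inter_subset G (ι '' In) (ι '' Blk) (ι '' U) (ι '' R) A)]
    at k
  rw [k]
  -- the window sums agree termwise (the off-wired window event lies in the wired one)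
  congr 1
  refine Finset.sum_congr rfl fun ζ _ => @if_congr _ _ _ (_) (_) _ _ _ _ ?_ rfl rfl
  rw [Set.inter_eq_right.2 (windowDatumEventOff_inter_subset In Blk U R AW)]

end Measure

/-! ### (T, off) The conditional inside probabilities agree in two graphs isomorphic on the
window -/

/-- **(T, off) Transport of the conditional inside probabilities, rim wired off the inside.** Two
finite graphs `G₁` on `V₁`, `G₂` on `V₂`, a finite window `W` embedded by `ι₁, ι₂` with the same
adjacency on the window and a deep part `W₀ ⊆ W` none of whose images has a neighbour off the window
(in either graph). For exploration data `In, Blk, U ⊆ W₀`, `R ⊆ W`, `x ∈ U`, with `Fᵢ` the saturated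
off-wired datum event `{ω | ω ∩ E(Gᵢ) ∈ {𝒞 = ιᵢ U, 𝒟 = ιᵢ R} ∩ {rim wired through ιᵢ U ∖ ιᵢ In}}`
and `Aᵢ` the inside piece `{ιᵢ x is joined inside ιᵢ U to a vertex carrying an open edge to ιᵢ R}`,
the free random-cluster measures satisfy `φ_{G₁}(F₁ ∩ A₁) φ_{G₂}(F₂) = φ_{G₂}(F₂ ∩ A₂) φ_{G₁}(F₁)`:
the conditional inside probabilities coincide (the window sums of the two graphs are the same,
`rcMeasure_real_explEventOff_inter_mul_eq_sum_window`). [cite: BasuSapozhnikov2017ECP, §2] -/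
theorem insideCond_eq_of_window_iso_off :
    ∀ {V₁ V₂ W : Type*} [Fintype V₁] [DecidableEq V₁] [Fintype V₂] [DecidableEq V₂] [Fintype W] [DecidableEq W]
      (G₁ : SimpleGraph V₁) [DecidableRel G₁.Adj] (G₂ : SimpleGraph V₂) [DecidableRel G₂.Adj]
      (ι₁ : W ↪ V₁) (ι₂ : W ↪ V₂) (W₀ : Set W) {p q : ℝ},
      p ∈ Set.Icc (0 : ℝ) 1 → 0 < q →
      (∀ a b : W, G₁.Adj (ι₁ a) (ι₁ b) ↔ G₂.Adj (ι₂ a) (ι₂ b)) →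
      (∀ a ∈ W₀, ∀ v : V₁, G₁.Adj (ι₁ a) v → ∃ b : W, v = ι₁ b) →
      (∀ a ∈ W₀, ∀ v : V₂, G₂.Adj (ι₂ a) v → ∃ b : W, v = ι₂ b) →
    ∀ (In Blk U R : Set W) (x : W),
      In ⊆ W₀ → Blk ⊆ W₀ → U ⊆ W₀ → x ∈ U →
      let F₁ : Set (BondConfig V₁) := {ω | ω ∩ (↑G₁.edgeFinset : Set (Sym2 V₁)) ∈
        explEvent (ι₁ '' In) (ι₁ '' Blk) (ι₁ '' U) (ι₁ '' R) ∩
          {ω | ∀ r ∈ ι₁ '' R, ∀ r₂ ∈ ι₁ '' R, ∃ v ∈ ι₁ '' U \ ι₁ '' In, ∃ v' ∈ ι₁ '' U \ ι₁ '' In,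
            s(v, r) ∈ ω ∧ s(v', r₂) ∈ ω ∧ ω ∈ openConnIn (ι₁ '' U \ ι₁ '' In) v v'}}
      let A₁ : Set (BondConfig V₁) := {ω | ∃ w ∈ ι₁ '' R, ∃ v ∈ ι₁ '' U,
        ω ∩ (↑G₁.edgeFinset : Set (Sym2 V₁)) ∈ openConnIn (ι₁ '' U) (ι₁ x) v ∧
          s(v, w) ∈ ω ∩ (↑G₁.edgeFinset : Set (Sym2 V₁))}
      let F₂ : Set (BondConfig V₂) := {ω | ω ∩ (↑G₂.edgeFinset : Set (Sym2 V₂)) ∈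
        explEvent (ι₂ '' In) (ι₂ '' Blk) (ι₂ '' U) (ι₂ '' R) ∩
          {ω | ∀ r ∈ ι₂ '' R, ∀ r₂ ∈ ι₂ '' R, ∃ v ∈ ι₂ '' U \ ι₂ '' In, ∃ v' ∈ ι₂ '' U \ ι₂ '' In,
            s(v, r) ∈ ω ∧ s(v', r₂) ∈ ω ∧ ω ∈ openConnIn (ι₂ '' U \ ι₂ '' In) v v'}}
      let A₂ : Set (BondConfig V₂) := {ω | ∃ w ∈ ι₂ '' R, ∃ v ∈ ι₂ '' U,
        ω ∩ (↑G₂.edgeFinset : Set (Sym2 V₂)) ∈ openConnIn (ι₂ '' U) (ι₂ x) v ∧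
          s(v, w) ∈ ω ∩ (↑G₂.edgeFinset : Set (Sym2 V₂))}
      (rcMeasure G₁ p q ∅).real (F₁ ∩ A₁) * (rcMeasure G₂ p q ∅).real F₂ =
        (rcMeasure G₂ p q ∅).real (F₂ ∩ A₂) * (rcMeasure G₁ p q ∅).real F₁ := by
  intro V₁ V₂ W _ _ _ _ _ _ G₁ _ G₂ _ ι₁ ι₂ W₀ p q hp hq hadj hnb₁ hnb₂ In Blk U R x _hIn _hBlk hUW₀
    _hx F₁ A₁ F₂ A₂
  classical
  -- the window pairs touching `U` that are edges (the same for the two graphs)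
  set TW : Finset (Sym2 W) :=
    Finset.univ.filter (fun e => Sym2.map ι₁ e ∈ G₁.edgeSet ∧ ∃ v ∈ U, v ∈ e) with hTWdef
  have hTW₁ : ∀ e, e ∈ TW ↔ Sym2.map ι₁ e ∈ G₁.edgeSet ∧ ∃ v ∈ U, v ∈ e := fun e => by
    rw [hTWdef, Finset.mem_filter, and_iff_right (Finset.mem_univ e)]
  have hTW₂ : ∀ e, e ∈ TW ↔ Sym2.map ι₂ e ∈ G₂.edgeSet ∧ ∃ v ∈ U, v ∈ e := fun e => by
    rw [hTW₁]
    induction e using Sym2.ind with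
    | h a b => rw [Sym2.map_mk, Sym2.map_mk, mem_edgeSet, mem_edgeSet, hadj a b]
  have hU₁ : ∀ a ∈ U, ∀ v : V₁, G₁.Adj (ι₁ a) v → ∃ b : W, v = ι₁ b := fun a ha => hnb₁ a (hUW₀ ha)
  have hU₂ : ∀ a ∈ U, ∀ v : V₂, G₂.Adj (ι₂ a) v → ∃ b : W, v = ι₂ b := fun a ha => hnb₂ a (hUW₀ ha)
  obtain ⟨c₁, d₁, hc₁, h₁⟩ :=
    rcMeasure_real_explEventOff_inter_mul_eq_sum_window G₁ ι₁ hp hq In Blk U R hU₁ TW hTW₁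
  obtain ⟨c₂, d₂, hc₂, h₂⟩ :=
    rcMeasure_real_explEventOff_inter_mul_eq_sum_window G₂ ι₂ hp hq In Blk U R hU₂ TW hTW₂
  -- the four factorised probabilities (inside piece / whole datum event, in either graph)
  set AW : Set (BondConfig W) := {ζ | ∃ w ∈ R, ∃ v ∈ U, ζ ∈ openConnIn U x v ∧ s(v, w) ∈ ζ}
  have h1A := h₁ A₁ AW
    (insidePiece_iff_of_inter_eq G₁ (mem_map_sym2Map_iff_touching G₁ ι₁ hU₁ hTW₁))
    (fun ζ hζ => coe_map_mem_insidePiece_iff G₁ ι₁ hTW₁ ζ hζ)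
  have h2A := h₂ A₂ AW
    (insidePiece_iff_of_inter_eq G₂ (mem_map_sym2Map_iff_touching G₂ ι₂ hU₂ hTW₂))
    (fun ζ hζ => coe_map_mem_insidePiece_iff G₂ ι₂ hTW₂ ζ hζ)
  have h1u := h₁ Set.univ Set.univ (fun _ _ _ => Iff.rfl) fun _ _ => Iff.rfl
  have h2u := h₂ Set.univ Set.univ (fun _ _ _ => Iff.rfl) fun _ _ => Iff.rfl
  rw [Set.inter_univ F₁] at h1u
  rw [Set.inter_univ F₂] at h2u
  have key : ((rcMeasure G₁ p q ∅).real (F₁ ∩ A₁) * c₁) * ((rcMeasure G₂ p q ∅).real F₂ * c₂) =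
      ((rcMeasure G₂ p q ∅).real (F₂ ∩ A₂) * c₂) * ((rcMeasure G₁ p q ∅).real F₁ * c₁) := by
    rw [h1A, h1u, h2A, h2u]; ring
  apply mul_left_cancel₀ (mul_ne_zero hc₁.ne' hc₂.ne')
  linear_combination key

end Literature.Probability.LatticeModels
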